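import Literature.AlgebraicGeometry.Motives.GrassmannianSplitSurjectionPoints
import HarnessLib

/-!
# The kernel of a split surjection of free modules in coordinates: `ker S` is spanned by the columns of `1 - R S`

Topic `AlgebraicGeometry/Motives`; namespace `Literature.AlgebraicGeometry.Motives.Grassmannian`. THEOREMS ONLY (no definition, no
instance, no notation, no named fact, no `sorry`).

Coordinate bookkeeping for ★ `Motives/GrassmannianSplitSurjectionPoints.matLinMap` (a rectangular matrix `S ∈ M_{m×n}(A)` acting
`A ⊗ M → A ⊗ M'` through bases `b`, `b'`), used by the local triviality of projective bundles to compare «the relations of `G` die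
in the quotient» (★ `Motives/ProjectiveBundleOfQuotientPoints.exists_lift_iff`) with «the quotient factors through `S`»
(★ `exists_eq_splitPrecompHom_iff`):

* `matLinMap_sum_tmul` — `S(Σ_j c_j ⊗ b_j) = Σ_i (S c)_i ⊗ b'_i`; `sum_tmul_eq_zero_iff` — `Σ_j c_j ⊗ b_j = 0 ↔ c = 0`;
  `sum_tmul_mem_ker_matLinMap_iff` — `Σ_j c_j ⊗ b_j ∈ ker S ↔ S c = 0`;
* **`ker_matLinMap_le_span_columns`** — for ANY `R ∈ M_{n×m}(A)`: `ker S ≤ span_A {Σ_j (1 - R S)_{jl} ⊗ b_j | l}` (if `S c = 0` then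
  `c = (1 - R S) c`); with `S R = 1` the columns of `1 - R S` lie in `ker S` (`mulVec_one_sub_mul_eq_zero`), so the span IS the kernel
  (`ker_matLinMap_eq_span_columns`) — the standard splitting `A^n = R(A^m) ⊕ ker S` [GortzWedhorn2020, (8.4); Prop. 8.17 (2) context].

## References
* [GortzWedhorn2020] U. Görtz, T. Wedhorn, *Algebraic Geometry I*, 2nd ed. (2020), Prop. 8.17 (2), (8.4) (pp. 213–215).
* [StacksProject] The Stacks project, Tag 089R.
-/

set_option autoImplicit false

noncomputable section

universe u v v' w

open TensorProduct Function Matrix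

namespace Literature.AlgebraicGeometry.Motives

namespace Grassmannian

variable {R₀ : Type u} [CommRing R₀] {M : Type v} [AddCommGroup M] [Module R₀ M] {M' : Type v'} [AddCommGroup M'] [Module R₀ M']
  {n m : Type*} [Fintype n] [Fintype m] (b : Module.Basis n R₀ M) (b' : Module.Basis m R₀ M')
variable {A : Type w} [CommRing A] [Algebra R₀ A]

/-- Coordinates of `Σ_j c_j ⊗ b_j`: `tensorCoord b (Σ_j c_j ⊗ b_j) = c`. [cite: StacksProject, Tag 089R] -/
theorem tensorCoord_sum_tmul (c : n → A) : tensorCoord b A (∑ j, c j ⊗ₜ[R₀] b j) = c := by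
  have h : (∑ j, c j ⊗ₜ[R₀] b j) = (tensorCoord b A).symm c := by
    rw [tensorCoord_symm_apply]
    refine Finset.sum_congr rfl fun j _ => ?_
    rw [TensorProduct.smul_tmul', smul_eq_mul, mul_one]
  rw [h, LinearEquiv.apply_symm_apply]

/-- `Σ_j c_j ⊗ b_j = tensorCoord⁻¹ c`. [cite: StacksProject, Tag 089R] -/
theorem sum_tmul_eq_tensorCoord_symm (c : n → A) : (∑ j, c j ⊗ₜ[R₀] b j) = (tensorCoord b A).symm c := by
  rw [LinearEquiv.eq_symm_apply, tensorCoord_sum_tmul]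

/-- **`Σ_j c_j ⊗ b_j = 0 ↔ c = 0`** (the `1 ⊗ b_j` form a basis). [cite: StacksProject, Tag 089R] -/
theorem sum_tmul_eq_zero_iff (c : n → A) : (∑ j, c j ⊗ₜ[R₀] b j) = 0 ↔ c = 0 := by
  rw [sum_tmul_eq_tensorCoord_symm b c, LinearEquiv.map_eq_zero_iff]

/-- **`S(Σ_j c_j ⊗ b_j) = Σ_i (S c)_i ⊗ b'_i`**. [cite: GortzWedhorn2020, Prop. 8.17 (2)] -/
theorem matLinMap_sum_tmul (S : Matrix m n A) (c : n → A) :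
    matLinMap b b' S (∑ j, c j ⊗ₜ[R₀] b j) = ∑ i, (S *ᵥ c) i ⊗ₜ[R₀] b' i := by
  rw [matLinMap_apply, tensorCoord_sum_tmul, sum_tmul_eq_tensorCoord_symm b']

/-- **`Σ_j c_j ⊗ b_j ∈ ker S ↔ S c = 0`**. [cite: GortzWedhorn2020, Prop. 8.17 (2)] -/
theorem sum_tmul_mem_ker_matLinMap_iff (S : Matrix m n A) (c : n → A) :
    (∑ j, c j ⊗ₜ[R₀] b j) ∈ LinearMap.ker (matLinMap b b' S) ↔ S *ᵥ c = 0 := by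
  rw [LinearMap.mem_ker, matLinMap_sum_tmul, sum_tmul_eq_zero_iff]

variable [DecidableEq n]

/-- **`ker S ≤ span {columns of 1 - R S}`** for ANY `R`: if `S c = 0` then `c = (1 - R S) c = Σ_l c_l · col_l(1 - R S)`.
[cite: GortzWedhorn2020, Prop. 8.17 (2)] -/
theorem ker_matLinMap_le_span_columns (S : Matrix m n A) (R : Matrix n m A) :
    LinearMap.ker (matLinMap b b' S) ≤
      Submodule.span A (Set.range fun l : n => ∑ j, ((1 : Matrix n n A) - R * S) j l ⊗ₜ[R₀] b j) := by
  intro x hx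
  -- write `x` in coordinates
  set c := tensorCoord b A x with hc
  have hxc : x = ∑ j, c j ⊗ₜ[R₀] b j := by
    rw [sum_tmul_eq_tensorCoord_symm, hc, LinearEquiv.symm_apply_apply]
  rw [hxc, sum_tmul_mem_ker_matLinMap_iff] at hx
  -- `c = (1 - R S) c`, i.e. `c_j = Σ_l (1 - R S)_{jl} c_l`
  have hcc : ∀ j, c j = ∑ l, ((1 : Matrix n n A) - R * S) j l * c l := fun j => by
    have h := congrFun (Matrix.one_mulVec c).symm j
    rw [show (1 : Matrix n n A) = (1 - R * S) + R * S by rw [sub_add_cancel], Matrix.add_mulVec, Pi.add_apply,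
      ← Matrix.mulVec_mulVec, hx, Matrix.mulVec_zero, Pi.zero_apply, add_zero] at h
    rw [h, Matrix.mulVec, dotProduct]
  have hx' : x = ∑ l, c l • ∑ j, ((1 : Matrix n n A) - R * S) j l ⊗ₜ[R₀] b j := by
    rw [hxc]
    simp_rw [Finset.smul_sum, TensorProduct.smul_tmul', smul_eq_mul]
    rw [Finset.sum_comm]
    refine Finset.sum_congr rfl fun j _ => ?_
    rw [← TensorProduct.sum_tmul, hcc j]
    refine congrArg (· ⊗ₜ[R₀] b j) (Finset.sum_congr rfl fun l _ => mul_comm _ _)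
  rw [hx']
  exact Submodule.sum_mem _ fun l _ => Submodule.smul_mem _ _ (Submodule.subset_span ⟨l, rfl⟩)

variable [DecidableEq m]

/-- With `S R = 1` the columns of `1 - R S` lie in `ker S`: `S (1 - R S) = 0`. [cite: GortzWedhorn2020, Prop. 8.17 (2)] -/
theorem mul_one_sub_mul_eq_zero {S : Matrix m n A} {R : Matrix n m A} (h : S * R = 1) : S * (1 - R * S) = 0 := by
  rw [Matrix.mul_sub, Matrix.mul_one, ← Matrix.mul_assoc, h, Matrix.one_mul, sub_self]

/-- With `S R = 1`: each column `Σ_j (1 - R S)_{jl} ⊗ b_j` lies in `ker S`. [cite: GortzWedhorn2020, Prop. 8.17 (2)] -/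
theorem column_mem_ker_matLinMap {S : Matrix m n A} {R : Matrix n m A} (h : S * R = 1) (l : n) :
    (∑ j, ((1 : Matrix n n A) - R * S) j l ⊗ₜ[R₀] b j) ∈ LinearMap.ker (matLinMap b b' S) := by
  rw [sum_tmul_mem_ker_matLinMap_iff]
  funext i
  have h0 := congrFun (congrFun (mul_one_sub_mul_eq_zero h) i) l
  rw [Matrix.mul_apply] at h0
  rw [Matrix.mulVec, dotProduct, Pi.zero_apply]
  simpa using h0

/-- **`ker S = span {columns of 1 - R S}`** when `S R = 1`. [cite: GortzWedhorn2020, Prop. 8.17 (2)] -/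
theorem ker_matLinMap_eq_span_columns {S : Matrix m n A} {R : Matrix n m A} (h : S * R = 1) :
    LinearMap.ker (matLinMap b b' S) = Submodule.span A (Set.range fun l : n => ∑ j, ((1 : Matrix n n A) - R * S) j l ⊗ₜ[R₀] b j) := by
  refine le_antisymm (ker_matLinMap_le_span_columns b b' S R) (Submodule.span_le.mpr ?_)
  rintro _ ⟨l, rfl⟩
  exact column_mem_ker_matLinMap b b' h l

end Grassmannian

end Literature.AlgebraicGeometry.Motives

end
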